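import Summits.QuantumFields.YangMills.Theorems.VirialFluxGapGibbsMeanWindowOfEulerFieldFamily
import Summits.QuantumFields.YangMills.Theorems.VirialFluxGapPeriodicSoftnessOfSmoothFrameField
import HarnessLib

/-!
# Route `SwapVirialDeficit` ∕ `VirialFluxGap` (YangMills): the `∀δ` Gibbs-mean window bound (P) — hence ⟨24196⟩ `ToronSoftnessSharp` — from a
# `δ`-FAMILY OF SMOOTH FRAME FIELDS on `X_fix` with two pointwise inequalities (the last-mile socket of the (P) road; LEAD ym-line-sfw-p2 g97)

LEAD ym-line-sfw-p2 g97 (cell ym-idea-1, free hands; `--supports stmt-QuantumFields-24196`).  This is w2 g52's last-mile reduction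
✓`periodicSoftness_of_smoothFrameField_inline ∕ _cutoff` RERUN against the sharp socket ✓`TreeGaugeTransfer.gibbsMeanWindow_of_eulerFieldFixFamily`
(this seat, ✓p828109): every regularity clause of «EulerFieldFix» is automatic for a smooth frame field (✓`fixUnitCurve_field_package`), so the
(P) road to ⟨24196⟩ needs exactly: for every `δ > 0`, constants `K, q, L₀` and for every `L ≥ L₀` smooth coefficients `c_va` (`va : FixVar L × Fin 3`,
frame ✓`fixFrameStd`) and `0 ≤ ε ≤ 1/4` with `ε·L⁴ ≤ δ` such that, with `M_x = ringCoord (glue x.1 ∷ x.2.1, x.2.2)`,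
  (drive)       `2(1−ε)·F_fix(x) − E(x) ≤ Σ_va c_va(M_x)·frameGrad fixFrameStd M_x va`   (`E` an admissible error term),
  (divergence)  `Σ_va frameD (fixFrameStd va) (c va) M_x ≤ 18L⁴ − 3 + δ`.

* ★★ `gibbsMeanWindow_of_smoothFrameFieldFamily` (error term as data) and ★★★ `gibbsMeanWindow_of_smoothFrameFieldFamily_cutoff` (error term built in:
  `K ≥ 240`, `q ≥ 4`; (positivity) everywhere, (drive) on `{F_fix < (K·L^q)⁻¹}`, (divergence) everywhere) ⟹ (P):
  `∀ δ′ > 0 ∃ a > 0 ∃ β₀ L₀, β ≥ β₀ → L₀ ≤ L ≤ β^a → β·∫F₀e^{−βF₀}/∫e^{−βF₀} ≤ 9L⁴ − 3/2 + δ′`;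
* ★★★ `toronSoftnessSharp_of_smoothFrameFieldFamily_cutoff` — ⟨24196⟩ BY NAME from such a family (✓`toronSoftnessSharp_of_gibbsMeanWindow`);
* ★★★ `swapMeanActionGap_of_smoothFrameFieldFamily_cutoff_of_sharpSectorLaplace` — ⟨24194⟩ BY NAME from such a family AND the two per-sector sharp
  Laplace laws (S) of the σ ring (✓`swapMeanActionGap_of_gibbsMeanWindow_of_sharpSectorLaplace`).

The family itself is the `δ`-rerun of the ⟨24141⟩ assembly with the sharp counts ✓`fix_generic_divergence_upper_six` (generic, `18L⁴ − 3 + o(1)`) and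
✓`central_divergence_window_sharp` (central, `18L⁴ − 3 + 12ρ′²`) and `δ`-dependent parameters — NOT in this file.  HONEST LABEL: a REDUCTION
(theorems only, 0 `def`, 0 `sorry`, standard axioms); no field is constructed; ⟨24196⟩ ∕ ⟨24194⟩ ∕ ⟨24197⟩ OPEN; own crux ⟨22884⟩ OPEN (blocked-on
⟨19935⟩); the Yang–Mills mass gap is NOT proved; no summit is proved by a line.
References: [cite: Griffiths1964]; [cite: SeilerLNP1982, §2]; [cite: Luscher1983, §2].
-/

set_option autoImplicit false

noncomputable section

open scoped Matrix BigOperators ContDiff Topology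
open MeasureTheory
open Literature.MathematicalPhysics.QuantumFieldTheory hiding SU2
open Literature.MathematicalPhysics.QuantumLattice

namespace Summit.QuantumFields.YangMills.Theorems.VirialFluxGap.FixField

open Summit.QuantumFields.YangMills.Theorems.FemtoTransferGap
open Summit.QuantumFields.YangMills.Theorems.FemtoTransferGap.TT
open Summit.QuantumFields.YangMills.Theorems.VirialFluxGap.RingDeficit
open Summit.QuantumFields.YangMills.Theorems.VirialFluxGap.FrameDerivative
open Summit.QuantumFields.YangMills.Theorems.VirialFluxGap.FrameHessian
open Summit.QuantumFields.YangMills.Theorems.VirialFluxGap.FixFrame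
open Summit.QuantumFields.YangMills.Theorems.VirialFluxGap.TreeGaugeTransfer (gibbsMeanWindow_of_eulerFieldFixFamily)

variable {L : ℕ} [NeZero L]

open scoped Matrix.Norms.Frobenius

/-! ## §1 (P) from a `δ`-family of smooth frame fields, error term as data -/

/-- ★★ **The `∀δ′` Gibbs-mean window bound (P) from a `δ`-family of smooth frame fields on `X_fix`.**  For every `δ > 0`: constants `K ≥ 1`, `q ≥ 0`,
`L₀`, and for every `L ≥ L₀` smooth coefficients `c_va`, an error term `E` (measurable, `0 ≤ E ≤ K·L^q`, vanishing where `F_fix < (K·L^q)⁻¹`),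
`0 ≤ ε ≤ 1/4` with `ε·L⁴ ≤ δ`, the DRIVE inequality `2(1−ε)F_fix(x) − E x ≤ Σ_va c_va(M_x)·frameGrad fixFrameStd M_x va` and the SHARP DIVERGENCE
inequality `Σ_va frameD (fixFrameStd va) (c va) M_x ≤ 18L⁴ − 3 + δ`.  Conclusion: (P) `β·∫F₀e^{−βF₀}/∫e^{−βF₀} ≤ 9L⁴ − 3/2 + δ′` on a window `L ≤ β^a`,
for every `δ′ > 0` (via ✓`gibbsMeanWindow_of_eulerFieldFixFamily`, all regularity clauses by ✓`fixUnitCurve_field_package`).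
[cite: Griffiths1964] [cite: SeilerLNP1982, §2] -/
theorem gibbsMeanWindow_of_smoothFrameFieldFamily
    (h : ∀ δ : ℝ, 0 < δ → ∃ K : ℝ, 1 ≤ K ∧ ∃ q : ℝ, 0 ≤ q ∧ ∃ L₀ : ℕ, ∀ (L : ℕ) [NeZero L], L₀ ≤ L →
      ∃ (c : FixVar L × Fin 3 → ((Fin (2 * L - 1 + 1) → Edge 3 L → Matrix (Fin 2) (Fin 2) ℂ) × (Site 3 L → Matrix (Fin 2) (Fin 2) ℂ)) → ℝ)
        (E : (OffIdx L → SU2) × ((Fin (2 * L - 1) → GaugeConfig 3 L SU2) × (Site 3 L → SU2)) → ℝ) (ε : ℝ),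
        (∀ va, ContDiff ℝ ∞ (c va)) ∧ Measurable E ∧ (∀ x, 0 ≤ E x) ∧ (∀ x, E x ≤ K * (L : ℝ) ^ q) ∧
        (∀ x : (OffIdx L → SU2) × ((Fin (2 * L - 1) → GaugeConfig 3 L SU2) × (Site 3 L → SU2)), ringDeficit L (fun _ => false)
          ((Fin.cons (glue x.1) x.2.1 : Fin (2 * L - 1 + 1) → GaugeConfig 3 L SU2), x.2.2) < (K * (L : ℝ) ^ q)⁻¹ → E x = 0) ∧
        0 ≤ ε ∧ ε ≤ 1 / 4 ∧ ε * (L : ℝ) ^ 4 ≤ δ ∧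
        (∀ x : (OffIdx L → SU2) × ((Fin (2 * L - 1) → GaugeConfig 3 L SU2) × (Site 3 L → SU2)), 2 * (1 - ε) * ringDeficit L (fun _ => false)
            ((Fin.cons (glue x.1) x.2.1 : Fin (2 * L - 1 + 1) → GaugeConfig 3 L SU2), x.2.2) - E x ≤
          ∑ va, c va (ringCoord L ((Fin.cons (glue x.1) x.2.1 : Fin (2 * L - 1 + 1) → GaugeConfig 3 L SU2), x.2.2)) *
            frameGrad (L := L) fixFrameStd (ringCoord L ((Fin.cons (glue x.1) x.2.1 : Fin (2 * L - 1 + 1) → GaugeConfig 3 L SU2), x.2.2)) va) ∧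
        (∀ x : (OffIdx L → SU2) × ((Fin (2 * L - 1) → GaugeConfig 3 L SU2) × (Site 3 L → SU2)), ∑ va, frameD (fixFrameStd va) (c va)
            (ringCoord L ((Fin.cons (glue x.1) x.2.1 : Fin (2 * L - 1 + 1) → GaugeConfig 3 L SU2), x.2.2)) ≤ 18 * (L : ℝ) ^ 4 - 3 + δ)) :
    ∀ δ' : ℝ, 0 < δ' → ∃ a : ℝ, 0 < a ∧ ∃ β₀ : ℝ, ∃ L₀ : ℕ, ∀ β : ℝ, β₀ ≤ β → ∀ (L : ℕ) [NeZero L], L₀ ≤ L → (L : ℝ) ≤ β ^ a →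
      β * (∫ p, ringDeficit L (fun _ => false) p * Real.exp (-(β * ringDeficit L (fun _ => false) p)) ∂(ringMeasure L)) /
          (∫ p, Real.exp (-(β * ringDeficit L (fun _ => false) p)) ∂(ringMeasure L)) ≤ 9 * (L : ℝ) ^ 4 - 3 / 2 + δ' := by
  refine gibbsMeanWindow_of_eulerFieldFixFamily fun δ hδ => ?_
  obtain ⟨K, hK, q, hq, L₀, hfield⟩ := h δ hδ
  refine ⟨K, hK, q, hq, L₀, fun L _ hL => ?_⟩
  obtain ⟨c, E, ε, hc, hEm, hE0, hEle, hEsupp, hε0, hε4, hεL, hdrive, hdiv⟩ := hfield L hL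
  obtain ⟨hγ, hφm, B, hφb, hDφ, hDF, hDφb, hDFb, hDφm, hDFm⟩ := fixUnitCurve_field_package (L := L) hc
  -- reindex the frame by `Fin n`
  set e : Fin (Fintype.card (FixVar L × Fin 3)) ≃ FixVar L × Fin 3 := (Fintype.equivFin (FixVar L × Fin 3)).symm with he
  refine ⟨Fintype.card (FixVar L × Fin 3), fun j => fixUnitCurve (e j),
    fun j x => c (e j) (ringCoord L ((Fin.cons (glue x.1) x.2.1 : Fin (2 * L - 1 + 1) → GaugeConfig 3 L SU2), x.2.2)),
    fun j t x => frameD (fixFrameStd (e j)) (c (e j)) (ringCoord L ((Fin.cons (glue (x * fixUnitCurve (e j) t).1)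
      (x * fixUnitCurve (e j) t).2.1 : Fin (2 * L - 1 + 1) → GaugeConfig 3 L SU2), (x * fixUnitCurve (e j) t).2.2)),
    fun j t x => frameGrad (L := L) fixFrameStd (ringCoord L ((Fin.cons (glue (x * fixUnitCurve (e j) t).1)
      (x * fixUnitCurve (e j) t).2.1 : Fin (2 * L - 1 + 1) → GaugeConfig 3 L SU2), (x * fixUnitCurve (e j) t).2.2)) (e j),
    E, ε, 1, B, fun j => hγ (e j), fun j => hφm (e j), fun j x => hφb (e j) x, one_pos,
    fun j x t _ => hDφ (e j) x t, fun j x t _ => hDF (e j) x t, fun j x t _ => hDφb (e j) x t, fun j x t _ => hDFb (e j) x t,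
    fun j => hDφm (e j), fun j => hDFm (e j), hEm, hE0, hEle, hEsupp, hε0, hε4, hεL, fun x => ?_, fun x => ?_⟩
  · -- drive: the `Fin n`-sum at `t = 0` is the frame sum at the point
    have hsum : ∑ j, c (e j) (ringCoord L ((Fin.cons (glue x.1) x.2.1 : Fin (2 * L - 1 + 1) → GaugeConfig 3 L SU2), x.2.2)) *
        frameGrad (L := L) fixFrameStd (ringCoord L ((Fin.cons (glue (x * fixUnitCurve (e j) 0).1)
          (x * fixUnitCurve (e j) 0).2.1 : Fin (2 * L - 1 + 1) → GaugeConfig 3 L SU2), (x * fixUnitCurve (e j) 0).2.2)) (e j) =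
        ∑ va, c va (ringCoord L ((Fin.cons (glue x.1) x.2.1 : Fin (2 * L - 1 + 1) → GaugeConfig 3 L SU2), x.2.2)) *
          frameGrad (L := L) fixFrameStd (ringCoord L ((Fin.cons (glue x.1) x.2.1 : Fin (2 * L - 1 + 1) → GaugeConfig 3 L SU2), x.2.2)) va := by
      simp only [fixUnitCurve_zero, mul_one]
      exact Equiv.sum_comp e (fun va => c va (ringCoord L ((Fin.cons (glue x.1) x.2.1 : Fin (2 * L - 1 + 1) → GaugeConfig 3 L SU2), x.2.2)) *
        frameGrad (L := L) fixFrameStd (ringCoord L ((Fin.cons (glue x.1) x.2.1 : Fin (2 * L - 1 + 1) → GaugeConfig 3 L SU2), x.2.2)) va)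
    rw [hsum]
    exact hdrive x
  · -- divergence
    have hsum : ∑ j, frameD (fixFrameStd (e j)) (c (e j)) (ringCoord L ((Fin.cons (glue (x * fixUnitCurve (e j) 0).1)
          (x * fixUnitCurve (e j) 0).2.1 : Fin (2 * L - 1 + 1) → GaugeConfig 3 L SU2), (x * fixUnitCurve (e j) 0).2.2)) =
        ∑ va, frameD (fixFrameStd va) (c va)
          (ringCoord L ((Fin.cons (glue x.1) x.2.1 : Fin (2 * L - 1 + 1) → GaugeConfig 3 L SU2), x.2.2)) := by
      simp only [fixUnitCurve_zero, mul_one]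
      exact Equiv.sum_comp e (fun va => frameD (fixFrameStd va) (c va)
        (ringCoord L ((Fin.cons (glue x.1) x.2.1 : Fin (2 * L - 1 + 1) → GaugeConfig 3 L SU2), x.2.2)))
    rw [hsum]
    exact hdiv x

/-! ## §2 (P) from a `δ`-family of smooth frame fields, error term built in -/

/-- ★★★ **(P) from a `δ`-family of smooth frame fields on `X_fix` — CUT-OFF VERSION WITH THE ERROR TERM BUILT IN.**  For every `δ > 0`: `K ≥ 240`,
`q ≥ 4`, `L₀`, and for every `L ≥ L₀` smooth coefficients `c_va` and `0 ≤ ε ≤ 1/4` with `ε·L⁴ ≤ δ` such that, with `M_x = ringCoord (glue x.1 ∷ x.2.1, x.2.2)`,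
(positivity) `0 ≤ Σ_va c_va(M_x)·frameGrad fixFrameStd M_x va` EVERYWHERE, (drive) `2(1−ε)F_fix(x) ≤ Σ_va c_va(M_x)·frameGrad fixFrameStd M_x va` on
`{F_fix < (K·L^q)⁻¹}`, and (divergence) `Σ_va frameD (fixFrameStd va) (c va) M_x ≤ 18L⁴ − 3 + δ` EVERYWHERE.  Conclusion: (P) for every `δ′ > 0`
(the error term `E := 2(1−ε)F_fix·𝟙{F_fix ≥ (K·L^q)⁻¹} ≤ 240L⁴ ≤ K·L^q` by ✓`RingDeficit.ringDeficit_le_poly` is supplied here).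
[cite: Griffiths1964] [cite: SeilerLNP1982, §2] -/
theorem gibbsMeanWindow_of_smoothFrameFieldFamily_cutoff
    (h : ∀ δ : ℝ, 0 < δ → ∃ K : ℝ, 240 ≤ K ∧ ∃ q : ℝ, 4 ≤ q ∧ ∃ L₀ : ℕ, ∀ (L : ℕ) [NeZero L], L₀ ≤ L →
      ∃ (c : FixVar L × Fin 3 → ((Fin (2 * L - 1 + 1) → Edge 3 L → Matrix (Fin 2) (Fin 2) ℂ) × (Site 3 L → Matrix (Fin 2) (Fin 2) ℂ)) → ℝ) (ε : ℝ),
        (∀ va, ContDiff ℝ ∞ (c va)) ∧ 0 ≤ ε ∧ ε ≤ 1 / 4 ∧ ε * (L : ℝ) ^ 4 ≤ δ ∧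
        (∀ x : (OffIdx L → SU2) × ((Fin (2 * L - 1) → GaugeConfig 3 L SU2) × (Site 3 L → SU2)), 0 ≤ ∑ va, c va (ringCoord L ((Fin.cons (glue x.1) x.2.1 : Fin (2 * L - 1 + 1) → GaugeConfig 3 L SU2), x.2.2)) * frameGrad (L := L) fixFrameStd (ringCoord L ((Fin.cons (glue x.1) x.2.1 : Fin (2 * L - 1 + 1) → GaugeConfig 3 L SU2), x.2.2)) va) ∧
        (∀ x : (OffIdx L → SU2) × ((Fin (2 * L - 1) → GaugeConfig 3 L SU2) × (Site 3 L → SU2)), ringDeficit L (fun _ => false) ((Fin.cons (glue x.1) x.2.1 : Fin (2 * L - 1 + 1) → GaugeConfig 3 L SU2), x.2.2) < (K * (L : ℝ) ^ q)⁻¹ →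
          2 * (1 - ε) * ringDeficit L (fun _ => false) ((Fin.cons (glue x.1) x.2.1 : Fin (2 * L - 1 + 1) → GaugeConfig 3 L SU2), x.2.2) ≤
            ∑ va, c va (ringCoord L ((Fin.cons (glue x.1) x.2.1 : Fin (2 * L - 1 + 1) → GaugeConfig 3 L SU2), x.2.2)) * frameGrad (L := L) fixFrameStd (ringCoord L ((Fin.cons (glue x.1) x.2.1 : Fin (2 * L - 1 + 1) → GaugeConfig 3 L SU2), x.2.2)) va) ∧
        (∀ x : (OffIdx L → SU2) × ((Fin (2 * L - 1) → GaugeConfig 3 L SU2) × (Site 3 L → SU2)), ∑ va, frameD (fixFrameStd va) (c va) (ringCoord L ((Fin.cons (glue x.1) x.2.1 : Fin (2 * L - 1 + 1) → GaugeConfig 3 L SU2), x.2.2)) ≤ 18 * (L : ℝ) ^ 4 - 3 + δ)) :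
    ∀ δ' : ℝ, 0 < δ' → ∃ a : ℝ, 0 < a ∧ ∃ β₀ : ℝ, ∃ L₀ : ℕ, ∀ β : ℝ, β₀ ≤ β → ∀ (L : ℕ) [NeZero L], L₀ ≤ L → (L : ℝ) ≤ β ^ a →
      β * (∫ p, ringDeficit L (fun _ => false) p * Real.exp (-(β * ringDeficit L (fun _ => false) p)) ∂(ringMeasure L)) /
          (∫ p, Real.exp (-(β * ringDeficit L (fun _ => false) p)) ∂(ringMeasure L)) ≤ 9 * (L : ℝ) ^ 4 - 3 / 2 + δ' := by
  refine gibbsMeanWindow_of_smoothFrameFieldFamily fun δ hδ => ?_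
  obtain ⟨K, hK, q, hq, L₀, hfield⟩ := h δ hδ
  refine ⟨K, by linarith, q, by linarith, L₀, fun L _ hL => ?_⟩
  obtain ⟨c, ε, hc, hε0, hε4, hεL, hpos, hdrive, hdiv⟩ := hfield L hL
  have hL1 : (1 : ℝ) ≤ L := by exact_mod_cast NeZero.one_le
  have hT : 240 * (L : ℝ) ^ 4 ≤ K * (L : ℝ) ^ q := by
    have h4 : (L : ℝ) ^ 4 ≤ (L : ℝ) ^ q := by
      rw [show ((L : ℝ) ^ 4 : ℝ) = (L : ℝ) ^ ((4 : ℕ) : ℝ) from (Real.rpow_natCast _ 4).symm]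
      exact Real.rpow_le_rpow_of_exponent_le hL1 (by norm_num; linarith)
    have hL4 : (0 : ℝ) ≤ (L : ℝ) ^ 4 := by positivity
    nlinarith
  have hFm := TreeGaugeTransfer.measurable_fixDeficit (L := L)
  refine ⟨c, fun x => if ringDeficit L (fun _ => false) ((Fin.cons (glue x.1) x.2.1 : Fin (2 * L - 1 + 1) → GaugeConfig 3 L SU2), x.2.2) < (K * (L : ℝ) ^ q)⁻¹ then 0
      else 2 * (1 - ε) * ringDeficit L (fun _ => false) ((Fin.cons (glue x.1) x.2.1 : Fin (2 * L - 1 + 1) → GaugeConfig 3 L SU2), x.2.2), ε, hc, ?_, fun x => ?_, fun x => ?_, fun x hx => ?_,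
    hε0, hε4, hεL, fun x => ?_, hdiv⟩
  · exact Measurable.ite (measurableSet_lt hFm measurable_const) measurable_const (hFm.const_mul _)
  · dsimp only
    split_ifs
    · exact le_rfl
    · exact mul_nonneg (by linarith) (ringDeficit_nonneg _ _)
  · dsimp only
    split_ifs
    · have : (0 : ℝ) ≤ (L : ℝ) ^ q := Real.rpow_nonneg (by positivity) q
      nlinarith
    · have hF := RingDeficit.ringDeficit_le_poly (L := L) (fun _ => false) ((Fin.cons (glue x.1) x.2.1 : Fin (2 * L - 1 + 1) → GaugeConfig 3 L SU2), x.2.2)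
      have hF0 := ringDeficit_nonneg (L := L) (fun _ => false) ((Fin.cons (glue x.1) x.2.1 : Fin (2 * L - 1 + 1) → GaugeConfig 3 L SU2), x.2.2)
      nlinarith
  · dsimp only
    rw [if_pos hx]
  · dsimp only
    split_ifs with hx
    · rw [sub_zero]
      exact hdrive x hx
    · rw [sub_self]
      exact hpos x

/-! ## §3 ⟨24196⟩ and ⟨24194⟩ by name -/

/-- ★★★ **⟨24196⟩ `SwapVirialDeficit.ToronSoftnessSharp` BY NAME from a `δ`-family of smooth frame fields on `X_fix`** with positivity, drive on the
small-deficit window, and the sharp divergence count `18L⁴ − 3 + δ` (`ε·L⁴ ≤ δ`): §2 and ✓`toronSoftnessSharp_of_gibbsMeanWindow`.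
[cite: tHooft1979] [cite: Luscher1983, §2] [cite: Griffiths1964] -/
theorem toronSoftnessSharp_of_smoothFrameFieldFamily_cutoff
    (h : ∀ δ : ℝ, 0 < δ → ∃ K : ℝ, 240 ≤ K ∧ ∃ q : ℝ, 4 ≤ q ∧ ∃ L₀ : ℕ, ∀ (L : ℕ) [NeZero L], L₀ ≤ L →
      ∃ (c : FixVar L × Fin 3 → ((Fin (2 * L - 1 + 1) → Edge 3 L → Matrix (Fin 2) (Fin 2) ℂ) × (Site 3 L → Matrix (Fin 2) (Fin 2) ℂ)) → ℝ) (ε : ℝ),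
        (∀ va, ContDiff ℝ ∞ (c va)) ∧ 0 ≤ ε ∧ ε ≤ 1 / 4 ∧ ε * (L : ℝ) ^ 4 ≤ δ ∧
        (∀ x : (OffIdx L → SU2) × ((Fin (2 * L - 1) → GaugeConfig 3 L SU2) × (Site 3 L → SU2)), 0 ≤ ∑ va, c va (ringCoord L ((Fin.cons (glue x.1) x.2.1 : Fin (2 * L - 1 + 1) → GaugeConfig 3 L SU2), x.2.2)) * frameGrad (L := L) fixFrameStd (ringCoord L ((Fin.cons (glue x.1) x.2.1 : Fin (2 * L - 1 + 1) → GaugeConfig 3 L SU2), x.2.2)) va) ∧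
        (∀ x : (OffIdx L → SU2) × ((Fin (2 * L - 1) → GaugeConfig 3 L SU2) × (Site 3 L → SU2)), ringDeficit L (fun _ => false) ((Fin.cons (glue x.1) x.2.1 : Fin (2 * L - 1 + 1) → GaugeConfig 3 L SU2), x.2.2) < (K * (L : ℝ) ^ q)⁻¹ →
          2 * (1 - ε) * ringDeficit L (fun _ => false) ((Fin.cons (glue x.1) x.2.1 : Fin (2 * L - 1 + 1) → GaugeConfig 3 L SU2), x.2.2) ≤
            ∑ va, c va (ringCoord L ((Fin.cons (glue x.1) x.2.1 : Fin (2 * L - 1 + 1) → GaugeConfig 3 L SU2), x.2.2)) * frameGrad (L := L) fixFrameStd (ringCoord L ((Fin.cons (glue x.1) x.2.1 : Fin (2 * L - 1 + 1) → GaugeConfig 3 L SU2), x.2.2)) va) ∧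
        (∀ x : (OffIdx L → SU2) × ((Fin (2 * L - 1) → GaugeConfig 3 L SU2) × (Site 3 L → SU2)), ∑ va, frameD (fixFrameStd va) (c va) (ringCoord L ((Fin.cons (glue x.1) x.2.1 : Fin (2 * L - 1 + 1) → GaugeConfig 3 L SU2), x.2.2)) ≤ 18 * (L : ℝ) ^ 4 - 3 + δ)) :
    Summit.QuantumFields.YangMills.Theses.SwapVirialDeficit.ToronSoftnessSharp :=
  Summit.QuantumFields.YangMills.Theorems.SwapVirialDeficit.SectorMixture.toronSoftnessSharp_of_gibbsMeanWindow
    (gibbsMeanWindow_of_smoothFrameFieldFamily_cutoff h)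

/-- ★★★ **⟨24194⟩ `SwapVirialDeficit.SwapMeanActionGap` BY NAME from a `δ`-family of smooth frame fields on `X_fix` (the (P) road) AND the two
per-sector sharp two-sided Laplace laws (S) of the σ-glued ring** (`z = 000, 001`; free constants, power rate):
§2 and ✓`swapMeanActionGap_of_gibbsMeanWindow_of_sharpSectorLaplace`. [cite: tHooft1979] [cite: Luscher1983, §2] [cite: Griffiths1964] -/
theorem swapMeanActionGap_of_smoothFrameFieldFamily_cutoff_of_sharpSectorLaplace
    (h : ∀ δ : ℝ, 0 < δ → ∃ K : ℝ, 240 ≤ K ∧ ∃ q : ℝ, 4 ≤ q ∧ ∃ L₀ : ℕ, ∀ (L : ℕ) [NeZero L], L₀ ≤ L →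
      ∃ (c : FixVar L × Fin 3 → ((Fin (2 * L - 1 + 1) → Edge 3 L → Matrix (Fin 2) (Fin 2) ℂ) × (Site 3 L → Matrix (Fin 2) (Fin 2) ℂ)) → ℝ) (ε : ℝ),
        (∀ va, ContDiff ℝ ∞ (c va)) ∧ 0 ≤ ε ∧ ε ≤ 1 / 4 ∧ ε * (L : ℝ) ^ 4 ≤ δ ∧
        (∀ x : (OffIdx L → SU2) × ((Fin (2 * L - 1) → GaugeConfig 3 L SU2) × (Site 3 L → SU2)), 0 ≤ ∑ va, c va (ringCoord L ((Fin.cons (glue x.1) x.2.1 : Fin (2 * L - 1 + 1) → GaugeConfig 3 L SU2), x.2.2)) * frameGrad (L := L) fixFrameStd (ringCoord L ((Fin.cons (glue x.1) x.2.1 : Fin (2 * L - 1 + 1) → GaugeConfig 3 L SU2), x.2.2)) va) ∧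
        (∀ x : (OffIdx L → SU2) × ((Fin (2 * L - 1) → GaugeConfig 3 L SU2) × (Site 3 L → SU2)), ringDeficit L (fun _ => false) ((Fin.cons (glue x.1) x.2.1 : Fin (2 * L - 1 + 1) → GaugeConfig 3 L SU2), x.2.2) < (K * (L : ℝ) ^ q)⁻¹ →
          2 * (1 - ε) * ringDeficit L (fun _ => false) ((Fin.cons (glue x.1) x.2.1 : Fin (2 * L - 1 + 1) → GaugeConfig 3 L SU2), x.2.2) ≤
            ∑ va, c va (ringCoord L ((Fin.cons (glue x.1) x.2.1 : Fin (2 * L - 1 + 1) → GaugeConfig 3 L SU2), x.2.2)) * frameGrad (L := L) fixFrameStd (ringCoord L ((Fin.cons (glue x.1) x.2.1 : Fin (2 * L - 1 + 1) → GaugeConfig 3 L SU2), x.2.2)) va) ∧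
        (∀ x : (OffIdx L → SU2) × ((Fin (2 * L - 1) → GaugeConfig 3 L SU2) × (Site 3 L → SU2)), ∑ va, frameD (fixFrameStd va) (c va) (ringCoord L ((Fin.cons (glue x.1) x.2.1 : Fin (2 * L - 1 + 1) → GaugeConfig 3 L SU2), x.2.2)) ≤ 18 * (L : ℝ) ^ 4 - 3 + δ))
    (hS : ∃ a : ℝ, 0 < a ∧ ∃ K : ℝ, 0 < K ∧ ∃ q : ℝ, 0 ≤ q ∧ ∃ θ : ℝ, 0 < θ ∧ θ ≤ 1 ∧ ∃ e₀ e₁ C₀ C₁ : ℕ → ℝ, ∃ β₀ : ℝ, ∃ L₀ : ℕ,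
      (∀ L : ℕ, L₀ ≤ L → 9 * (L : ℝ) ^ 4 - 1 ≤ e₀ L ∧ e₀ L ≤ 9 * (L : ℝ) ^ 4 ∧ 9 * (L : ℝ) ^ 4 - 1 ≤ e₁ L ∧ e₁ L ≤ 9 * (L : ℝ) ^ 4) ∧
      ∀ b : ℝ, β₀ ≤ b → ∀ (L : ℕ) [NeZero L], L₀ ≤ L → (L : ℝ) ≤ b ^ a →
        |Real.log (∫ P, Real.exp (-(b * Summit.QuantumFields.YangMills.Theorems.SwapVirialDeficit.SwapRing.swapRingDeficit L (fun _ => false) P)) ∂(ringMeasure L)) - (-(e₀ L) * Real.log b + C₀ L)| ≤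
            K * (L : ℝ) ^ q * b ^ (-θ) ∧
        |Real.log (∫ P, Real.exp (-(b * Summit.QuantumFields.YangMills.Theorems.SwapVirialDeficit.SwapRing.swapRingDeficit L (fun k => decide (k = 2)) P)) ∂(ringMeasure L)) - (-(e₁ L) * Real.log b + C₁ L)| ≤
            K * (L : ℝ) ^ q * b ^ (-θ)) :
    Summit.QuantumFields.YangMills.Theses.SwapVirialDeficit.SwapMeanActionGap :=
  Summit.QuantumFields.YangMills.Theorems.SwapVirialDeficit.SectorMixture.swapMeanActionGap_of_gibbsMeanWindow_of_sharpSectorLaplace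
    (gibbsMeanWindow_of_smoothFrameFieldFamily_cutoff h) hS

end Summit.QuantumFields.YangMills.Theorems.VirialFluxGap.FixField

end
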